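import Summits.ResolutionOfSingularities.ResolutionOfSingularities.Theorems.EquisingularLiftEquisingularLiftNatSingularVectors
import HarnessLib

/-!
# [OURS] FINITELY MANY SINGULAR VECTORS ⟹ THE NON-REGULAR LOCUS OF `V₊(F)` IS A FINITE SET OF CLOSED POINTS — the polynomial certificate for
# hypothesis #2 `Set.Finite {x | ¬ IsRegularLocalRing (𝒪_{H,x})}` of the registered n = 3 residual stubs
# (cruxes `Theses.EquisingularLift.EquisingularLiftNat` / `…NatThree`, stmt-ResolutionOfSingularities-20038 / -20148; every dimension, `K = K̄`)

[OURS · leafhand-res-equisingularlift-10 g1, 2026-08-31; cell `pub/decomp-res`] AI-produced, weaker than expert review; NOT a statement of any manuscript;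
nothing here proves resolution of singularities in positive characteristic.  DEF-FREE helper; no `sorry`; standard axioms; ZERO named hypotheses.

The two registered `n = 3` residual stubs of EL♮(3) split on `Set.Finite {x : H | ¬ IsRegularLocalRing (H.presheaf.stalk x)}` (isolated singularities:
`stub_elnat_three_isolated_nonNDLeaves9`; non-isolated: `stub_elnat_three_nonisolated_…`).  For a coordinate hypersurface `H = V₊(F)` this file decides that
hypothesis from the polynomial data, completing the closed-point Jacobian dictionary of ✓ `…NatSingularVectors` (p830488):

* ★★ `SingLocus.mem_basicOpen_of_linearForms_mem` — a point `x` «over the vector `v`» (every linear form through `v` lies in `𝔮_{ι x}`) lies in EVERY chart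
  `D₊(x_c)` with `v_c ≠ 0`, and such a `c` exists;
* ★★★ `SingLocus.eq_of_linearForms_mem` — **at most ONE point of `V₊(F)` lies over a given vector** (closed or not): in the chart `x_c = 1` its prime contains
  `y_j − v_j/v_c`, so by the Nullstellensatz it is the maximal ideal of the affine trace of `v`, and the chart is injective on primes;
* ★★★ `SingLocus.finite_setOf_not_isRegularLocalRing` — **`F` a prime form over `K = K̄` whose non-zero singular vectors are multiples of the members of a
  finite set `V` ⟹ `{x : V₊(F) | 𝒪_x not regular}` is FINITE** (✓ `isRegularLocalRing_stalk_of_singularVectors`: every non-regular point lies over some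
  `v ∈ V`; at most one point over each `v`);
* ★★ `SingLocus.finite_setOf_not_isRegularLocalRing_linAut` — the same keyed by per-point linear coordinates `(g, c)` (singular vectors killed by the
  `ℓ_a = linSubst ↑g (x_a)`, `a ≠ c`), the form used by the lh10 capstones.

Honest label: closes no registered stub; it is the polynomial test for WHICH of the two registered `n = 3` residues a given `V₊(F)` belongs to.

References: [Hartshorne1977, I Thm. 5.1, I Ex. 5.8, II Prop. 2.5]; [Matsumura1987, Thm. 14.2]; Hilbert's Nullstellensatz (Mathlib) — through the cited
tree files.
-/

set_option linter.dupNamespace false -- mandated namespace `Summit.<Summit>.<Problem>` of this single-conjunct summit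

noncomputable section

open CategoryTheory CategoryTheory.Limits AlgebraicGeometry TopologicalSpace
open MvPolynomial HomogeneousLocalization
open Literature.AlgebraicGeometry.Resolution Literature.AlgebraicGeometry.Motives Literature.AlgebraicGeometry.GroupSchemes
open Literature.AlgebraicGeometry.Motives.SmoothHypersurface Literature.AlgebraicGeometry.Motives.ProjectiveSpace
open AlgebraicGeometry.Scheme.IdealSheafData
open Summit.ResolutionOfSingularities.ResolutionOfSingularities.Cruxes.EquisingularLift.StrataSplit

namespace Summit.ResolutionOfSingularities.ResolutionOfSingularities.Cruxes.EquisingularLiftNat.Sections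

namespace SingLocus

variable (K : Type) [Field K] {m : ℕ} (F : MvPolynomial (Fin (m + 2 + 1)) K) {d : ℕ} (hF : F.IsHomogeneous d)

/-- The linear form `v_c·x_a − v_a·x_c` through `v`. [folklore] -/
theorem isHomogeneous_one_cross (v : Fin (m + 2 + 1) → K) (c a : Fin (m + 2 + 1)) :
    (C (v c) * X a - C (v a) * X c : MvPolynomial (Fin (m + 2 + 1)) K).IsHomogeneous 1 := by
  have h1 := (isHomogeneous_C (Fin (m + 2 + 1)) (v c)).mul (isHomogeneous_X K a)
  have h2 := (isHomogeneous_C (Fin (m + 2 + 1)) (v a)).mul (isHomogeneous_X K c)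
  rw [zero_add] at h1 h2
  exact h1.sub h2

/-- `(v_c·x_a − v_a·x_c)(v) = 0`. [folklore] -/
theorem eval_cross (v : Fin (m + 2 + 1) → K) (c a : Fin (m + 2 + 1)) :
    eval v (C (v c) * X a - C (v a) * X c : MvPolynomial (Fin (m + 2 + 1)) K) = 0 := by
  simp only [map_sub, map_mul, eval_C, eval_X]
  ring

/-- ★★ **A point over the vector `v` lies in every chart `D₊(x_c)` with `v_c ≠ 0`** (else `x_c ∈ 𝔮` and the linear forms `v_c x_a − v_a x_c ∈ 𝔮` put every
variable in `𝔮`, which would then contain the irrelevant ideal), **and some `v_c ≠ 0`** (else every variable is a linear form through `v = 0`).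
[OURS] [cite: Hartshorne1977, II Prop. 2.5] -/
theorem mem_basicOpen_of_linearForms_mem (v : Fin (m + 2 + 1) → K) :
    letI := MvPolynomial.gradedAlgebra (σ := Fin (m + 2 + 1)) (R := K)
    ∀ x : ↥(hypersurface F).left,
      (∀ ℓ : MvPolynomial (Fin (m + 2 + 1)) K, ℓ.IsHomogeneous 1 → eval v ℓ = 0 → ℓ ∈ ((hypersurfaceι F).left x).asHomogeneousIdeal) →
      (∃ c, v c ≠ 0) ∧
      ∀ c, v c ≠ 0 → (hypersurfaceι F).left x ∈ Proj.basicOpen (homogeneousSubmodule (Fin (m + 2 + 1)) K) (X c) := by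
  letI := MvPolynomial.gradedAlgebra (σ := Fin (m + 2 + 1)) (R := K)
  intro x hx
  -- if every variable lay in `𝔮_x`, `𝔮_x` would contain the irrelevant ideal
  have hirr : ¬ (∀ i : Fin (m + 2 + 1), (X i : MvPolynomial (Fin (m + 2 + 1)) K) ∈ ((hypersurfaceι F).left x).asHomogeneousIdeal) := by
    intro hall
    apply ((hypersurfaceι F).left x).not_irrelevant_le
    intro q hq
    have hle : Ideal.span (Set.range (X : Fin (m + 2 + 1) → MvPolynomial (Fin (m + 2 + 1)) K)) ≤
        ((hypersurfaceι F).left x).asHomogeneousIdeal.toIdeal := Ideal.span_le.mpr (Set.range_subset_iff.mpr hall)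
    exact hle (Segre.irrelevant_le_span_X (Fin (m + 2 + 1)) K hq)
  refine ⟨?_, fun c hvc => ?_⟩
  · by_contra h
    push Not at h
    exact hirr fun i => hx (X i) (isHomogeneous_X K i) (by rw [eval_X, h i])
  · refine (Proj.mem_basicOpen _ _ _).mpr fun hXc => ?_
    apply hirr
    intro a
    have hℓ := hx _ (isHomogeneous_one_cross K v c a) (eval_cross K v c a)
    have h1 : C (v c) * X a ∈ ((hypersurfaceι F).left x).asHomogeneousIdeal := by
      have h := Ideal.add_mem _ hℓ (Ideal.mul_mem_left _ (C (v a)) hXc)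
      rwa [sub_add_cancel] at h
    have h2 := Ideal.mul_mem_left _ (C (v c)⁻¹) h1
    rwa [← mul_assoc, ← map_mul, inv_mul_cancel₀ hvc, map_one, one_mul] at h2

include hF in
/-- ★★★ **AT MOST ONE POINT OF `V₊(F)` LIES OVER A GIVEN VECTOR** (`K = K̄`, `F` a prime form; points closed or not): if every linear form through `v`
lies in both `𝔮_{ι x}` and `𝔮_{ι x'}` then `x = x'`.  Chart `x_c = 1` with `v_c ≠ 0` (`mem_basicOpen_of_linearForms_mem`): the primes of `x, x'` in `K[y]`
contain `y_j − (v_j/v_c)` (✓ `HypersurfaceSpecimen.mem_asHomogeneousIdeal_chart_iff`), so by the Nullstellensatz both equal the maximal ideal of the affine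
trace `a = (v_j/v_c)_j`; the chart is injective on primes. [OURS] [cite: Hartshorne1977, II Prop. 2.5] -/
theorem eq_of_linearForms_mem [IsAlgClosed K] (hFp : Prime F) (v : Fin (m + 2 + 1) → K) :
    letI := MvPolynomial.gradedAlgebra (σ := Fin (m + 2 + 1)) (R := K)
    ∀ x x' : ↥(hypersurface F).left,
      (∀ ℓ : MvPolynomial (Fin (m + 2 + 1)) K, ℓ.IsHomogeneous 1 → eval v ℓ = 0 → ℓ ∈ ((hypersurfaceι F).left x).asHomogeneousIdeal) →
      (∀ ℓ : MvPolynomial (Fin (m + 2 + 1)) K, ℓ.IsHomogeneous 1 → eval v ℓ = 0 → ℓ ∈ ((hypersurfaceι F).left x').asHomogeneousIdeal) →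
      x = x' := by
  letI := MvPolynomial.gradedAlgebra (σ := Fin (m + 2 + 1)) (R := K)
  intro x x' hx hx'
  classical
  have hd : 0 < d := ConeN.pos_of_prime_of_isHomogeneous K F hF hFp
  obtain ⟨⟨c, hvc⟩, hxc⟩ := mem_basicOpen_of_linearForms_mem K F v x hx
  obtain ⟨-, hxc'⟩ := mem_basicOpen_of_linearForms_mem K F v x' hx'
  letI := ProjBaseChange.algebraBase (R := K) (homogeneousSubmodule (Fin (m + 2 + 1)) K)
    (Submonoid.powers (X c : MvPolynomial (Fin (m + 2 + 1)) K))
  -- both points in the chart `c`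
  have hxr : x ∈ Set.range (chart F c hF hd).left := by rw [range_chart_left]; exact hxc c hvc
  have hxr' : x' ∈ Set.range (chart F c hF hd).left := by rw [range_chart_left]; exact hxc' c hvc
  obtain ⟨w, rfl⟩ := hxr
  obtain ⟨w', rfl⟩ := hxr'
  set f := ProjectiveSpace.dehomogenize K c F with hfdef
  have hrad : (Ideal.span {f}).radical = Ideal.span {f} := by
    rcases ProjectiveSpace.irreducible_or_isUnit_dehomogenize (i := c) hF hFp.irreducible with hirr | hu
    · exact ((Ideal.span_singleton_prime hirr.ne_zero).mpr (UniqueFactorizationMonoid.irreducible_iff_prime.mp hirr)).radical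
    · rw [Ideal.span_singleton_eq_top.mpr hu, Ideal.radical_top]
  obtain ⟨θ, hθ⟩ := HypersurfaceSpecimen.exists_chartQuotEquiv_apply K F hF c f rfl hrad
  -- the affine trace of `v`
  let a : Fin (m + 2) → K := fun j => v (c.succAbove j) / v c
  -- the prime of a chart point over `v` is `𝔪_a`
  have hP : ∀ u : Spec (CommRingCat.of (ChartRing F c hF)),
      (∀ ℓ : MvPolynomial (Fin (m + 2 + 1)) K, ℓ.IsHomogeneous 1 → eval v ℓ = 0 →
        ℓ ∈ ((hypersurfaceι F).left ((chart F c hF hd).left u)).asHomogeneousIdeal) →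
      (u.asIdeal.comap θ.symm.toRingHom).comap (Ideal.Quotient.mk (Ideal.span {f})) =
        MvPolynomial.vanishingIdeal K ({a} : Set (Fin (m + 2) → K)) := by
    intro u hu
    set P := (u.asIdeal.comap θ.symm.toRingHom).comap (Ideal.Quotient.mk (Ideal.span {f})) with hPdef
    haveI : (u.asIdeal.comap θ.symm.toRingHom).IsPrime := Ideal.comap_isPrime _ _
    haveI hPprime : P.IsPrime := Ideal.comap_isPrime _ _
    -- dictionary for linear forms
    have hdict : ∀ {G : MvPolynomial (Fin (m + 2 + 1)) K}, G.IsHomogeneous 1 →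
        (G ∈ ((hypersurfaceι F).left ((chart F c hF hd).left u)).asHomogeneousIdeal ↔ ProjectiveSpace.dehomogenize K c G ∈ P) := by
      intro G hG
      have hG' : G ∈ homogeneousSubmodule (Fin (m + 2 + 1)) K 1 := (mem_homogeneousSubmodule 1 G).mpr hG
      rw [HypersurfaceSpecimen.mem_asHomogeneousIdeal_chart_iff K F hF hd c one_pos hG' u, hPdef, Ideal.mem_comap, Ideal.mem_comap,
        ← HypersurfaceSpecimen.chartAlgEquiv_isLocalizationElem K c hG', ← hθ]
      change _ ↔ θ.symm (θ _) ∈ u.asIdeal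
      rw [RingEquiv.symm_apply_apply]
    -- `y_j − a_j ∈ P`
    have hlin : ∀ j : Fin (m + 2), (X j - C (a j) : MvPolynomial (Fin (m + 2)) K) ∈ P := by
      intro j
      have hℓ : (X (c.succAbove j) - C (a j) * X c : MvPolynomial (Fin (m + 2 + 1)) K).IsHomogeneous 1 := by
        have h2 := (isHomogeneous_C (Fin (m + 2 + 1)) (a j)).mul (isHomogeneous_X K c)
        rw [zero_add] at h2
        exact (isHomogeneous_X K (c.succAbove j)).sub h2
      have hℓv : eval v (X (c.succAbove j) - C (a j) * X c : MvPolynomial (Fin (m + 2 + 1)) K) = 0 := by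
        simp only [map_sub, map_mul, eval_C, eval_X, a]
        rw [div_mul_cancel₀ _ hvc, sub_self]
      have h := (hdict hℓ).mp (hu _ hℓ hℓv)
      rwa [map_sub, map_mul, ProjectiveSpace.dehomogenize_X_succAbove, ProjectiveSpace.dehomogenize_X_self, mul_one,
        MvPolynomial.algHom_C] at h
    -- Nullstellensatz: `Z(P) ⊆ {a}`, so `P = 𝔪_a`
    have hZ : MvPolynomial.zeroLocus K P ⊆ ({a} : Set (Fin (m + 2) → K)) := by
      intro b hb
      rw [MvPolynomial.mem_zeroLocus_iff] at hb
      refine Set.mem_singleton_iff.mpr (funext fun j => ?_)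
      have h := hb _ (hlin j)
      change eval b (X j - C (a j)) = 0 at h
      rwa [map_sub, eval_X, eval_C, sub_eq_zero] at h
    have hle : MvPolynomial.vanishingIdeal K ({a} : Set (Fin (m + 2) → K)) ≤ P := by
      rw [← MvPolynomial.IsPrime.vanishingIdeal_zeroLocus (K := K) P]
      exact MvPolynomial.vanishingIdeal_anti_mono hZ
    have hmax : (MvPolynomial.vanishingIdeal K ({a} : Set (Fin (m + 2) → K)) : Ideal (MvPolynomial (Fin (m + 2)) K)).IsMaximal :=
      inferInstance
    exact (hmax.eq_of_le hPprime.ne_top hle).symm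
  -- the chart is injective on primes
  have hPP : (w.asIdeal.comap θ.symm.toRingHom).comap (Ideal.Quotient.mk (Ideal.span {f})) =
      (w'.asIdeal.comap θ.symm.toRingHom).comap (Ideal.Quotient.mk (Ideal.span {f})) := by rw [hP w hx, hP w' hx']
  have h1 : w.asIdeal.comap θ.symm.toRingHom = w'.asIdeal.comap θ.symm.toRingHom :=
    Ideal.comap_injective_of_surjective _ Ideal.Quotient.mk_surjective hPP
  have h2 : w.asIdeal = w'.asIdeal := Ideal.comap_injective_of_surjective _ θ.symm.surjective h1
  rw [PrimeSpectrum.ext h2]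

include hF in
/-- ★★★ **FINITELY MANY SINGULAR VECTORS ⟹ FINITE NON-REGULAR LOCUS** (`K = K̄`, every dimension): `F` a prime form, `V` a finite set of vectors such that
every `b ≠ 0` with `F(b) = 0`, `∇F(b) = 0` is a multiple of a member of `V`; then `{x : V₊(F) | 𝒪_{V₊(F),x} is not regular}` is finite — every non-regular point
lies over some `v ∈ V` (✓ `isRegularLocalRing_stalk_of_singularVectors`) and at most one point lies over each `v` (`eq_of_linearForms_mem`).  This is
hypothesis #2 `Set.Finite {x | ¬ IsRegularLocalRing _}` of the registered isolated residual stub, for `H = V₊(F)`, read off the polynomial data.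
[OURS] [cite: Hartshorne1977, I Thm. 5.1, I Ex. 5.8] [cite: Matsumura1987, Thm. 14.2] -/
theorem finite_setOf_not_isRegularLocalRing [IsAlgClosed K] (hFp : Prime F) (V : Finset (Fin (m + 2 + 1) → K))
    (hjac : ∀ b : Fin (m + 2 + 1) → K, b ≠ 0 → eval b F = 0 → (∀ i, eval b (pderiv i F) = 0) → ∃ v ∈ V, ∃ t : K, b = t • v) :
    letI := MvPolynomial.gradedAlgebra (σ := Fin (m + 2 + 1)) (R := K)
    Set.Finite {x : ↥(hypersurface F).left | ¬ IsRegularLocalRing ((hypersurface F).left.presheaf.stalk x)} := by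
  letI := MvPolynomial.gradedAlgebra (σ := Fin (m + 2 + 1)) (R := K)
  classical
  -- every non-regular point lies over some `v ∈ V`
  have hsub : {x : ↥(hypersurface F).left | ¬ IsRegularLocalRing ((hypersurface F).left.presheaf.stalk x)} ⊆
      ⋃ v ∈ (V : Set (Fin (m + 2 + 1) → K)), {x : ↥(hypersurface F).left |
        ∀ ℓ : MvPolynomial (Fin (m + 2 + 1)) K, ℓ.IsHomogeneous 1 → eval v ℓ = 0 → ℓ ∈ ((hypersurfaceι F).left x).asHomogeneousIdeal} := by
    intro x hx
    by_contra hcon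
    apply hx
    refine isRegularLocalRing_stalk_of_singularVectors K F hF hFp V hjac x fun v hv => ?_
    by_contra hno
    push Not at hno
    exact hcon (Set.mem_biUnion (Finset.mem_coe.mpr hv) hno)
  refine Set.Finite.subset (Set.Finite.biUnion V.finite_toSet fun v _ => Set.Subsingleton.finite ?_) hsub
  intro x hx x' hx'
  exact eq_of_linearForms_mem K F hF hFp v x x' hx hx'

include hF in
/-- ★★ **FINITE NON-REGULAR LOCUS, keyed by per-point linear coordinates** (`K = K̄`): if every non-zero singular vector of the prime form `F` is killed by the
linear forms `ℓ_a = linSubst ↑g (x_a)`, `a ≠ c`, of some `(g, c)` in a finite list, then `{x : V₊(F) | 𝒪_x not regular}` is finite (`V = {g⁻¹ e_c}`,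
✓ `eq_smul_vec_of_forall_eval_eq_zero`). [OURS] [cite: Hartshorne1977, I Thm. 5.1, II Example 7.1.1] -/
theorem finite_setOf_not_isRegularLocalRing_linAut [IsAlgClosed K] (hFp : Prime F) (pts : List (GL (Fin (m + 2 + 1)) K × Fin (m + 2 + 1)))
    (hjac : ∀ b : Fin (m + 2 + 1) → K, b ≠ 0 → eval b F = 0 → (∀ i, eval b (pderiv i F) = 0) →
      ∃ gc ∈ pts, ∀ a : Fin (m + 2 + 1), a ≠ gc.2 →
        eval b (ProjLinAction.linSubst K (gc.1 : Matrix (Fin (m + 2 + 1)) (Fin (m + 2 + 1)) K) (X a)) = 0) :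
    letI := MvPolynomial.gradedAlgebra (σ := Fin (m + 2 + 1)) (R := K)
    Set.Finite {x : ↥(hypersurface F).left | ¬ IsRegularLocalRing ((hypersurface F).left.presheaf.stalk x)} := by
  letI := MvPolynomial.gradedAlgebra (σ := Fin (m + 2 + 1)) (R := K)
  classical
  let vec : GL (Fin (m + 2 + 1)) K × Fin (m + 2 + 1) → (Fin (m + 2 + 1) → K) := fun gc =>
    ((gc.1⁻¹ : GL (Fin (m + 2 + 1)) K) : Matrix (Fin (m + 2 + 1)) (Fin (m + 2 + 1)) K).mulVec (Pi.single gc.2 (1 : K))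
  refine finite_setOf_not_isRegularLocalRing K F hF hFp (pts.map vec).toFinset fun b hb hFb hdFb => ?_
  obtain ⟨gc, hgc, hb0⟩ := hjac b hb hFb hdFb
  exact ⟨vec gc, List.mem_toFinset.mpr (List.mem_map.mpr ⟨gc, hgc, rfl⟩),
    ((gc.1 : Matrix (Fin (m + 2 + 1)) (Fin (m + 2 + 1)) K).mulVec b) gc.2, eq_smul_vec_of_forall_eval_eq_zero K gc.1 gc.2 b hb0⟩

end SingLocus

end Summit.ResolutionOfSingularities.ResolutionOfSingularities.Cruxes.EquisingularLiftNat.Sections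

end
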